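/-
Copyright: cell `pub-balaban-gaps` seat ne6 (gen 10) for the b2b-balaban T⁴-continuum CRUX team, row NE7b. Project licence.
-/
import Summits.QuantumFields.BalabanUV.T4Continuum.Spine.NE7b.GaussianTranslatedMass
import Literature.Analysis.OperatorTheory.CombesThomasBanded

/-!
# THE INDUCED MEAN DECAYS INTO THE PINNED REGION: the two displayed residuals of `…GaussianShiftedFibre` — the induced-mean
# energy `mᵀQm ≤ B₀` (R1″, buffer ∕ decay) and the translated restriction's large-field mass (window nesting) — as kernel
# MODEL lemmas, the decay supplied by the tree's Combes–Thomas estimate (row NE7b, node U5c)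

Cell `pub-balaban-gaps` (G2 seat ne6 = row NE7b) for `pub-balaban/t4`, spine estimate NE7b (`T4WeightBudget.RelWeightBound`; the
cell's OWN estimate — NOT PRINTED in [Bałaban 1983–89], NOT PROVED).  [folklore] real analysis ∕ finite sums over the OWNER lineage
`t4-ne7b-p1`'s kernel objects; NOTHING of Bałaban's is named, valued or asserted; no `T4Continuum/Support` leaf typed; zero `sorry`.

WHY.  `…NE7b.GaussianShiftedFibre.shiftedMoment_le_of_inducedMean_le` (OWNER g105) prices the exterior coupling `v` of a near block
by the INDUCED-MEAN ENERGY `mᵀQm`, `m = S⁻¹v`, on the support `Z` of the sacrificed form `Q` (displayed `hB : mᵀQm ≤ B₀`) and by the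
large-field mass `η` of the TRANSLATED restriction `F(· − m)` (displayed `hmass`) — both «NOT here» there.  The crux refuter's v69
(κ-ne7bref-g66-1) splits the residual: (R1′a) SUPPORT (a hypothesis on `v`), (R1′b) BUFFER ∕ DECAY («`|S₁₁⁻¹(z,y)| ≤ C₀(k₀∕c₀)^{d(z,y)}`
… buffer `R ≍ log p`»), (R1′c) WINDOW (nesting `|m_b| ≤ μ_b < θ_b`; σ-2 «one more MODEL lemma»).  THIS FILE types (R1′b) and σ-2 over
DISPLAYED data and feeds the decay from the TREE's `Literature.Analysis.OperatorTheory.combesThomas_banded` (Combes–Thomas 1973, finite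
banded vector form: `σ‖ω‖² ≤ ⟨ω,Sω⟩`, band for a pseudo-distance `d`, off-diagonal `≤ h`, `≤ z` neighbours, `h z (e^μ − 1) ≤ σ∕2`).

WHAT IS PROVED ([folklore]):
* §1 `isUnit_det_of_coercive`, `mulVec_inv_col`, **`abs_inv_le_of_banded`** (`|S⁻¹ i k| ≤ (2∕σ)·e^{−μ·d(i,k)}` for a coercive banded `S`).
* §2 `mulVec_eq_sum_support`, **`abs_inv_mulVec_le_sum`** (ANY decay letter `|S⁻¹ i k| ≤ C·e^{−μ d(i,k)}` + an exterior term `v`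
  supported on the interface `D` with `|v| ≤ V` there ⟹ `|m_j| ≤ C·V·Σ_{l ∈ D} e^{−μ d(j,l)}`), `sum_exp_le_card_mul_exp`,
  **`abs_inv_mulVec_le_buffer`** (`|m_j| ≤ C·V·#D·e^{−μR}` once `d(j, D) ≥ R` — the BUFFER).
* §3 `coupling_support`, `abs_coupling_le` (the reading `v = S₁₂x₂`: support = the coupling's rows; far small field `|x₂| ≤ p` on its
  column support and row sums `≤ s` give `V = s·p` — (R1′a)'s letters, displayed), `responseMap_spec` (`T = S⁻¹S₁₂` solves the GSFM
  junction's `hT`), **`rowSum_response_le`** (`Σ_a |T j a| ≤ C·s·Σ_{l∈D}e^{−μd(j,l)}` — the response map's ℓ∞ letter WITH DECAY, `t_Z`).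
* §4 `qf_eq_qf_restrict`, `dotProduct_restrict_self`, `qf_le_sum_sq_on`, **`qf_le_card_mul_sq`** (`Q` positive semidefinite living on
  `Z`, `Q ≤ q₀·1`: `mᵀQm ≤ q₀·#Z·ρ²` from `|m| ≤ ρ` ON `Z` ONLY — σ-1).
* §5 **`inducedMeanEnergy_le_of_decay`** (`B₀ := q₀·#Z·(C·V·#D·e^{−μR})²`), **`inducedMeanEnergy_le_of_banded`** (`C = 2∕σ` from §1),
  **`shiftedMoment_le_of_decay`** = the OWNER's `shiftedMoment_le_of_inducedMean_le` with `hB` DISCHARGED by the buffer: shift price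
  `exp((1+ε⁻¹)·q₀·#Z·(C V #D)²·e^{−2μR})` — `O(q₀#Z)` and free of the far volume as soon as `e^{μR} ≥ C·V·#D`.
* §6 `window_nesting` (`θ ≤ (u−m)ᵀQ_b(u−m)`, `mᵀQ_bm ≤ μ_b` ⟹ `(θ − (1+ε⁻¹)μ_b)∕(1+ε) ≤ uᵀQ_bu`; the OWNER's `qf_young`),
  **`translatedMass_le`** (= the OWNER's `GaussianTranslatedMass.translatedLargeFieldMass_le`
  — its locus, W-ne7bp1-g105-3 — ALIASED at nesting letters `μ_b ≥ mᵀQ_bm`; supplies `hmass` when the `μ_b` are small against `θ_b`), `windowEnergy_le_of_decay` (`μ_b ≤ q_b·#Z_b·(C·V·#D)²` WITHOUT a buffer —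
  windows may touch the interface; whether these sit below print's thresholds is (R1′c)'s maximum-principle clause, NOT decided here).
* §7 a toy (`S = 1` on two sites: the §1 hypotheses are jointly inhabited).
NOT HERE (honest): that Bałaban's fluctuation forms, restrictions and 𝐑-operation SUPPLY `σ, h, z, μ, D, V = s·p, R` with
`e^{μR} ≥ C V #D` and `μ_b` below the thresholds is the (A1c) INSTANCE (NC-NE7b-α UNRULED) — not claimed; the non-Gaussian
remainder (R2); anything of Bałaban's.  BY-NAME EFFECT ON THE WALL: NONE (model suppliers for two displayed hypotheses).
NE7b NOT PRINTED ∕ NOT PROVED; spine PROVED 0∕9; rung (B)+1 on ONE finite T⁴ — NOT infinite volume, NOT the mass gap, NOT Clay.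
HONEST DEPENDENCY: continuum YM on T⁴ ⇐ BetaPertH ∧ nine spine estimates (0∕9 proved); BetaPertH ⇐ (D1) ∧ (D4) ∧ CAP+tail.
-/

set_option autoImplicit false

open Matrix Finset MeasureTheory Real
open Summit.QuantumFields.BalabanUV.T4Continuum.NE7b.QuadFormSimDiag
open Summit.QuantumFields.BalabanUV.T4Continuum.NE7b.GaussianRestrictedMoment
open Summit.QuantumFields.BalabanUV.T4Continuum.NE7b.GaussianShiftedFibre
open Summit.QuantumFields.BalabanUV.T4Continuum.NE7b.GaussianTranslatedMass

namespace Summit.QuantumFields.BalabanUV.T4Continuum.NE7b.GaussianInducedMeanDecay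

variable {n : Type*} [Fintype n] [DecidableEq n]

/-! ## §1 The inverse of a coercive banded form decays (junction to the tree's Combes–Thomas estimate) -/

/-- A coercive real matrix (`σ‖ω‖² ≤ ⟨ω, Sω⟩`, `σ > 0`) has invertible determinant. [folklore] -/
theorem isUnit_det_of_coercive {S : Matrix n n ℝ} {σ : ℝ} (hσ : 0 < σ)
    (hpos : ∀ ω : n → ℝ, σ * (ω ⬝ᵥ ω) ≤ ω ⬝ᵥ S *ᵥ ω) : IsUnit S.det := by
  rw [isUnit_iff_ne_zero, Ne, ← Matrix.exists_mulVec_eq_zero_iff]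
  rintro ⟨v, hv, hSv⟩
  have h1 := hpos v
  rw [hSv, dotProduct_zero] at h1
  obtain ⟨j, hj⟩ := Function.ne_iff.mp hv
  have h2 : v j * v j ≤ v ⬝ᵥ v := by
    rw [dotProduct]
    exact Finset.single_le_sum (f := fun i => v i * v i) (fun i _ => mul_self_nonneg (v i)) (Finset.mem_univ j)
  have h3 : 0 < v j * v j := mul_self_pos.mpr hj
  nlinarith

/-- The `k`-th column of `S⁻¹` solves `S v = e_k`. [folklore] -/
theorem mulVec_inv_col {S : Matrix n n ℝ} (hdet : IsUnit S.det) (k : n) :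
    S *ᵥ (fun i => S⁻¹ i k) = Pi.single k 1 := by
  have h : (fun i => S⁻¹ i k) = S⁻¹ *ᵥ Pi.single k 1 := by
    rw [Matrix.mulVec_single_one]; rfl
  rw [h, Matrix.mulVec_mulVec, Matrix.mul_nonsing_inv _ hdet, Matrix.one_mulVec]

/-- **THE COVARIANCE OF A COERCIVE FINITE-RANGE FORM DECAYS EXPONENTIALLY** (junction to
`Literature.Analysis.OperatorTheory.combesThomas_banded`).  Let `S` be a real matrix with `σ‖ω‖² ≤ ⟨ω, Sω⟩` (`σ > 0`), banded for
a symmetric pseudo-distance `d` (`d(i,i) = 0`, triangle inequality; `S i k = 0` when `d(i,k) > 1`), off-diagonal entries `≤ h` in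
modulus, at most `z` indices within distance `1` of any index, and `h z (e^μ − 1) ≤ σ∕2` with `μ ≥ 0`.  Then
`|S⁻¹ i k| ≤ (2∕σ)·e^{−μ·d(i,k)}` for all `i, k`. [folklore; Combes–Thomas 1973 via the tree] -/
theorem abs_inv_le_of_banded (S : Matrix n n ℝ) (d : n → n → ℝ) (σ h z μ : ℝ) (hσ : 0 < σ) (hμ : 0 ≤ μ)
    (hd0 : ∀ i, d i i = 0) (hdsymm : ∀ i k, d i k = d k i) (hdtri : ∀ i j k, d i k ≤ d i j + d j k)
    (hband : ∀ i k, 1 < d i k → S i k = 0) (hh0 : 0 ≤ h) (hh : ∀ i k, i ≠ k → |S i k| ≤ h)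
    (hz : ∀ i, ((univ.filter fun k => k ≠ i ∧ d i k ≤ 1).card : ℝ) ≤ z)
    (hpos : ∀ ω : n → ℝ, σ * (ω ⬝ᵥ ω) ≤ ω ⬝ᵥ S *ᵥ ω) (hsmall : h * z * (Real.exp μ - 1) ≤ σ / 2) (i k : n) :
    |S⁻¹ i k| ≤ 2 / σ * Real.exp (-(μ * d i k)) :=
  Literature.Analysis.OperatorTheory.combesThomas_banded S d σ h z μ hσ hμ hd0 hdsymm hdtri hband hh0 hh hz hpos hsmall
    k (fun j => S⁻¹ j k) (mulVec_inv_col (isUnit_det_of_coercive hσ hpos) k) i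

/-! ## §2 The induced mean `m = S⁻¹v` of an exterior term supported on the interface -/

omit [DecidableEq n] in
/-- An entry of `M v` is a sum over the support of `v`. [folklore] -/
theorem mulVec_eq_sum_support (M : Matrix n n ℝ) (D : Finset n) (v : n → ℝ) (hvD : ∀ l, l ∉ D → v l = 0) (j : n) :
    (M *ᵥ v) j = ∑ l ∈ D, M j l * v l := by
  rw [Matrix.mulVec, dotProduct]
  exact (Finset.sum_subset (Finset.subset_univ D) fun l _ hl => by rw [hvD l hl, mul_zero]).symm

/-- **THE INDUCED MEAN UNDER A DECAY LETTER.**  If `|S⁻¹ i k| ≤ C·e^{−μ·d(i,k)}` (any source: §1, a maximum principle, a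
random-walk expansion) and the exterior term `v` is supported on the interface `D` with `|v l| ≤ V` there, then
`|(S⁻¹v) j| ≤ C·V·Σ_{l ∈ D} e^{−μ·d(j,l)}` for every `j`. [folklore] -/
theorem abs_inv_mulVec_le_sum (S : Matrix n n ℝ) {C μ : ℝ} (d : n → n → ℝ)
    (hdec : ∀ i k, |S⁻¹ i k| ≤ C * Real.exp (-(μ * d i k)))
    (D : Finset n) (v : n → ℝ) (hvD : ∀ l, l ∉ D → v l = 0) {V : ℝ} (hV : ∀ l ∈ D, |v l| ≤ V) (j : n) :
    |(S⁻¹ *ᵥ v) j| ≤ C * V * ∑ l ∈ D, Real.exp (-(μ * d j l)) := by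
  rw [mulVec_eq_sum_support S⁻¹ D v hvD j, Finset.mul_sum]
  refine (Finset.abs_sum_le_sum_abs _ _).trans (Finset.sum_le_sum fun l hl => ?_)
  rw [abs_mul]
  have h1 := hdec j l
  have h2 := hV l hl
  calc |S⁻¹ j l| * |v l| ≤ (C * Real.exp (-(μ * d j l))) * V :=
        mul_le_mul h1 h2 (abs_nonneg _) ((abs_nonneg _).trans h1)
    _ = C * V * Real.exp (-(μ * d j l)) := by ring

omit [Fintype n] [DecidableEq n] in
/-- The buffer sum: if every interface index is at distance `≥ R` from `j`, then `Σ_{l ∈ D} e^{−μ d(j,l)} ≤ #D·e^{−μR}`. [folklore] -/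
theorem sum_exp_le_card_mul_exp (D : Finset n) {μ R : ℝ} (d : n → n → ℝ) (j : n) (hμ : 0 ≤ μ) (hR : ∀ l ∈ D, R ≤ d j l) :
    ∑ l ∈ D, Real.exp (-(μ * d j l)) ≤ D.card * Real.exp (-(μ * R)) := by
  calc ∑ l ∈ D, Real.exp (-(μ * d j l)) ≤ ∑ l ∈ D, Real.exp (-(μ * R)) :=
        Finset.sum_le_sum fun l hl => Real.exp_le_exp.2 (by nlinarith [hR l hl, mul_le_mul_of_nonneg_left (hR l hl) hμ])
    _ = D.card * Real.exp (-(μ * R)) := by rw [Finset.sum_const, nsmul_eq_mul]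

/-- A decay letter has a non-negative constant. [folklore] -/
theorem decayConst_nonneg (S : Matrix n n ℝ) {C μ : ℝ} (d : n → n → ℝ)
    (hdec : ∀ i k, |S⁻¹ i k| ≤ C * Real.exp (-(μ * d i k))) (j : n) : 0 ≤ C := by
  by_contra hC
  exact absurd ((abs_nonneg _).trans (hdec j j)) (not_le.2 (mul_neg_of_neg_of_pos (not_le.1 hC) (Real.exp_pos _)))

/-- **THE BUFFER.**  Under a decay letter, an exterior term supported on the interface `D` with `|v| ≤ V` (`V ≥ 0`) there, and
`d(j, l) ≥ R` for all `l ∈ D` (the index `j` sits `R` layers inside): `|(S⁻¹v) j| ≤ C·V·#D·e^{−μR}`. [folklore] -/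
theorem abs_inv_mulVec_le_buffer (S : Matrix n n ℝ) {C μ : ℝ} (d : n → n → ℝ)
    (hdec : ∀ i k, |S⁻¹ i k| ≤ C * Real.exp (-(μ * d i k)))
    (D : Finset n) (v : n → ℝ) (hvD : ∀ l, l ∉ D → v l = 0) {V : ℝ} (hV0 : 0 ≤ V) (hV : ∀ l ∈ D, |v l| ≤ V) (j : n)
    (hμ : 0 ≤ μ) {R : ℝ} (hR : ∀ l ∈ D, R ≤ d j l) :
    |(S⁻¹ *ᵥ v) j| ≤ C * V * (D.card * Real.exp (-(μ * R))) := by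
  refine (abs_inv_mulVec_le_sum S d hdec D v hvD hV j).trans ?_
  exact mul_le_mul_of_nonneg_left (sum_exp_le_card_mul_exp D d j hμ hR)
    (mul_nonneg (decayConst_nonneg S d hdec j) hV0)

/-! ## §3 The reading `v = S₁₂ x₂`: support on the interface, size from the far small field -/

section Coupling
variable {m : Type*} [Fintype m]

omit [Fintype n] [DecidableEq n] in
/-- The exterior term `S₁₂x₂` is supported on the rows where the coupling lives (the interface `D`). [folklore] -/
theorem coupling_support (S₁₂ : Matrix n m ℝ) (D : Finset n) (hrow : ∀ l a, S₁₂ l a ≠ 0 → l ∈ D) (x₂ : m → ℝ) :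
    ∀ l, l ∉ D → (S₁₂ *ᵥ x₂) l = 0 := by
  intro l hl
  rw [Matrix.mulVec, dotProduct]
  refine Finset.sum_eq_zero fun a _ => ?_
  by_cases h : S₁₂ l a = 0
  · rw [h, zero_mul]
  · exact absurd (hrow l a h) hl

omit [Fintype n] [DecidableEq n] in
/-- **SIZE OF THE EXTERIOR TERM FROM THE FAR SMALL FIELD**: if the far field is `≤ p` in modulus on a set `N` containing the
coupling's column support and the coupling's absolute row sums are `≤ s`, then `|(S₁₂x₂) l| ≤ s·p`. [folklore] -/
theorem abs_coupling_le (S₁₂ : Matrix n m ℝ) (N : Finset m) (hcol : ∀ l a, S₁₂ l a ≠ 0 → a ∈ N)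
    (x₂ : m → ℝ) {p s : ℝ} (hp : 0 ≤ p) (hx : ∀ a ∈ N, |x₂ a| ≤ p) (hs : ∀ l, ∑ a, |S₁₂ l a| ≤ s) (l : n) :
    |(S₁₂ *ᵥ x₂) l| ≤ s * p := by
  rw [Matrix.mulVec, dotProduct]
  calc |∑ a, S₁₂ l a * x₂ a| ≤ ∑ a, |S₁₂ l a * x₂ a| := Finset.abs_sum_le_sum_abs _ _
    _ ≤ ∑ a, |S₁₂ l a| * p := Finset.sum_le_sum fun a _ => by
        rw [abs_mul]
        by_cases h : S₁₂ l a = 0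
        · rw [h, abs_zero, zero_mul, zero_mul]
        · exact mul_le_mul_of_nonneg_left (hx a (hcol l a h)) (abs_nonneg _)
    _ = (∑ a, |S₁₂ l a|) * p := by rw [Finset.sum_mul]
    _ ≤ s * p := mul_le_mul_of_nonneg_right (hs l) hp

/-- **THE RESPONSE MAP `T = S⁻¹S₁₂` SOLVES `S(Tx₂) = S₁₂x₂`** (the displayed relation `hT` of the GSFM junction). [folklore] -/
theorem responseMap_spec {S : Matrix n n ℝ} (hdet : IsUnit S.det) (S₁₂ : Matrix n m ℝ) (x₂ : m → ℝ) :
    S *ᵥ ((S⁻¹ * S₁₂) *ᵥ x₂) = S₁₂ *ᵥ x₂ := by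
  rw [Matrix.mulVec_mulVec, ← Matrix.mul_assoc, Matrix.mul_nonsing_inv _ hdet, Matrix.one_mul]

/-- **THE RESPONSE MAP'S ROW SUMS DECAY** (σ-1's letter `t_Z`): under a decay letter for `S⁻¹` and a coupling living on the rows
`D` with absolute row sums `≤ s`, the row `j` of `T = S⁻¹S₁₂` has `Σ_a |T j a| ≤ C·s·Σ_{l ∈ D} e^{−μ d(j,l)}` — hence
`≤ C·s·#D·e^{−μR}` for `j` at distance `≥ R` from `D` (by `sum_exp_le_card_mul_exp`). [folklore] -/
theorem rowSum_response_le (S : Matrix n n ℝ) {C μ : ℝ} (d : n → n → ℝ)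
    (hdec : ∀ i k, |S⁻¹ i k| ≤ C * Real.exp (-(μ * d i k))) (S₁₂ : Matrix n m ℝ) (D : Finset n)
    (hrow : ∀ l a, S₁₂ l a ≠ 0 → l ∈ D) {s : ℝ} (hs : ∀ l, ∑ a, |S₁₂ l a| ≤ s) (j : n) :
    ∑ a, |(S⁻¹ * S₁₂) j a| ≤ C * s * ∑ l ∈ D, Real.exp (-(μ * d j l)) := by
  have hC := decayConst_nonneg S d hdec j
  -- `|T j a| ≤ Σ_{l ∈ D} |S⁻¹ j l|·|S₁₂ l a|`
  have h1 : ∀ a, |(S⁻¹ * S₁₂) j a| ≤ ∑ l ∈ D, |S⁻¹ j l| * |S₁₂ l a| := by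
    intro a
    rw [Matrix.mul_apply, ← Finset.sum_subset (Finset.subset_univ D) (fun l _ hl => by
      rw [show S₁₂ l a = 0 from not_not.mp (mt (hrow l a) hl), mul_zero])]
    exact (Finset.abs_sum_le_sum_abs _ _).trans (le_of_eq (Finset.sum_congr rfl fun l _ => abs_mul _ _))
  calc ∑ a, |(S⁻¹ * S₁₂) j a| ≤ ∑ a, ∑ l ∈ D, |S⁻¹ j l| * |S₁₂ l a| := Finset.sum_le_sum fun a _ => h1 a
    _ = ∑ l ∈ D, |S⁻¹ j l| * ∑ a, |S₁₂ l a| := by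
        rw [Finset.sum_comm]; exact Finset.sum_congr rfl fun l _ => by rw [Finset.mul_sum]
    _ ≤ ∑ l ∈ D, (C * Real.exp (-(μ * d j l))) * s := Finset.sum_le_sum fun l _ =>
        mul_le_mul (hdec j l) (hs l) (Finset.sum_nonneg fun a _ => abs_nonneg _)
          (mul_nonneg hC (Real.exp_pos _).le)
    _ = C * s * ∑ l ∈ D, Real.exp (-(μ * d j l)) := by rw [Finset.mul_sum]; exact Finset.sum_congr rfl fun l _ => by ring

end Coupling

/-! ## §4 The energy of a form living on `Z` sees `m` on `Z` only -/

/-- A form whose columns vanish off `Z` does not see the components off `Z`. [folklore] -/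
theorem mulVec_eq_mulVec_restrict (Q : Matrix n n ℝ) (Z : Finset n) (hQZ : ∀ i j, j ∉ Z → Q i j = 0) (w : n → ℝ) :
    Q *ᵥ w = Q *ᵥ (fun i => if i ∈ Z then w i else 0) := by
  ext i
  simp only [Matrix.mulVec, dotProduct]
  refine Finset.sum_congr rfl fun j _ => ?_
  by_cases hj : j ∈ Z
  · rw [if_pos hj]
  · rw [hQZ i j hj, zero_mul, zero_mul]

/-- **RESTRICTION TO `Z`**: for `Q` positive semidefinite with columns vanishing off `Z`, `mᵀQm = m_Zᵀ Q m_Z` with `m_Z` the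
restriction of `m` to `Z`. [folklore] -/
theorem qf_eq_qf_restrict {Q : Matrix n n ℝ} (hQ : Q.PosSemidef) (Z : Finset n) (hQZ : ∀ i j, j ∉ Z → Q i j = 0)
    (w : n → ℝ) :
    w ⬝ᵥ (Q *ᵥ w) = (fun i => if i ∈ Z then w i else 0) ⬝ᵥ (Q *ᵥ fun i => if i ∈ Z then w i else 0) := by
  -- symmetry of `Q` (the tree's `…Beta.FP.WellConditionedInverseLocality.isSymm_of_posSemidef`; inline to avoid a cross-road import)
  have hsymm : Q.IsSymm := by
    have h := hQ.1
    rw [IsHermitian, conjTranspose_eq_transpose_of_trivial] at h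
    exact h
  calc w ⬝ᵥ (Q *ᵥ w) = w ⬝ᵥ (Q *ᵥ fun i => if i ∈ Z then w i else 0) := by rw [← mulVec_eq_mulVec_restrict Q Z hQZ w]
    _ = (fun i => if i ∈ Z then w i else 0) ⬝ᵥ (Q *ᵥ w) := dotProduct_mulVec_symm hsymm _ _
    _ = (fun i => if i ∈ Z then w i else 0) ⬝ᵥ (Q *ᵥ fun i => if i ∈ Z then w i else 0) := by
        rw [← mulVec_eq_mulVec_restrict Q Z hQZ w]

/-- The squared norm of the restriction is the sum of squares over `Z`. [folklore] -/
theorem dotProduct_restrict_self (Z : Finset n) (w : n → ℝ) :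
    (fun i => if i ∈ Z then w i else 0) ⬝ᵥ (fun i => if i ∈ Z then w i else 0) = ∑ i ∈ Z, w i ^ 2 := by
  have h : ∑ i ∈ Z, (if i ∈ Z then w i else 0) * (if i ∈ Z then w i else 0) =
      ∑ i, (if i ∈ Z then w i else 0) * (if i ∈ Z then w i else 0) :=
    Finset.sum_subset (Finset.subset_univ Z) fun i _ hi => by rw [if_neg hi, zero_mul]
  rw [dotProduct, ← h]
  exact Finset.sum_congr rfl fun i hi => by rw [if_pos hi, pow_two]

/-- **THE ENERGY ON `Z`**: `Q` positive semidefinite, columns vanishing off `Z`, `Q ≤ q₀·1` ⟹ `mᵀQm ≤ q₀·Σ_{i ∈ Z} m_i²`. [folklore] -/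
theorem qf_le_sum_sq_on {Q : Matrix n n ℝ} (hQ : Q.PosSemidef) (Z : Finset n) (hQZ : ∀ i j, j ∉ Z → Q i j = 0)
    {q₀ : ℝ} (hQq : (q₀ • (1 : Matrix n n ℝ) - Q).PosSemidef) (w : n → ℝ) :
    w ⬝ᵥ (Q *ᵥ w) ≤ q₀ * ∑ i ∈ Z, w i ^ 2 := by
  rw [qf_eq_qf_restrict hQ Z hQZ w, ← dotProduct_restrict_self Z w]
  set w' : n → ℝ := fun i => if i ∈ Z then w i else 0
  have h0 := qf_nonneg_of_posSemidef hQq w'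
  rw [Matrix.sub_mulVec, Matrix.smul_mulVec, Matrix.one_mulVec, dotProduct_sub, dotProduct_smul, smul_eq_mul] at h0
  linarith

/-- **THE ENERGY FROM A SUP BOUND ON `Z` ONLY** (σ-1's `t_Z`): `|m_i| ≤ ρ` for `i ∈ Z` ⟹ `mᵀQm ≤ q₀·#Z·ρ²`. [folklore] -/
theorem qf_le_card_mul_sq {Q : Matrix n n ℝ} (hQ : Q.PosSemidef) (Z : Finset n) (hQZ : ∀ i j, j ∉ Z → Q i j = 0)
    {q₀ : ℝ} (hQq : (q₀ • (1 : Matrix n n ℝ) - Q).PosSemidef) (hq₀ : 0 ≤ q₀) (w : n → ℝ) {ρ : ℝ}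
    (hρ : ∀ i ∈ Z, |w i| ≤ ρ) :
    w ⬝ᵥ (Q *ᵥ w) ≤ q₀ * Z.card * ρ ^ 2 := by
  refine (qf_le_sum_sq_on hQ Z hQZ hQq w).trans ?_
  rw [mul_assoc]
  refine mul_le_mul_of_nonneg_left ?_ hq₀
  calc ∑ i ∈ Z, w i ^ 2 ≤ ∑ i ∈ Z, ρ ^ 2 := Finset.sum_le_sum fun i hi => by
        rw [← sq_abs]
        exact pow_le_pow_left₀ (abs_nonneg _) (hρ i hi) 2
    _ = Z.card * ρ ^ 2 := by rw [Finset.sum_const, nsmul_eq_mul]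

/-! ## §5 The induced-mean energy `B₀` from decay + buffer, and the shifted moment with `hB` discharged -/

/-- **THE INDUCED-MEAN ENERGY UNDER A DECAY LETTER AND A BUFFER** (residual (R1″) ∕ (R1′b) in model form).  Decay letter
`|S⁻¹ i k| ≤ C·e^{−μ d(i,k)}` (`μ ≥ 0`); `Q` positive semidefinite living on `Z` with `Q ≤ q₀·1` (`q₀ ≥ 0`); exterior term `v`
supported on the interface `D` with `|v| ≤ V` (`V ≥ 0`) there; buffer `d(i,l) ≥ R` for `i ∈ Z`, `l ∈ D`.  Then
`mᵀQm ≤ q₀·#Z·(C·V·#D·e^{−μR})²` for `m = S⁻¹v`. [folklore] -/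
theorem inducedMeanEnergy_le_of_decay (S Q : Matrix n n ℝ) {C μ : ℝ} (d : n → n → ℝ) (hμ : 0 ≤ μ)
    (hdec : ∀ i k, |S⁻¹ i k| ≤ C * Real.exp (-(μ * d i k)))
    (hQ : Q.PosSemidef) (Z : Finset n) (hQZ : ∀ i j, j ∉ Z → Q i j = 0) {q₀ : ℝ} (hq₀ : 0 ≤ q₀)
    (hQq : (q₀ • (1 : Matrix n n ℝ) - Q).PosSemidef)
    (D : Finset n) (v : n → ℝ) (hvD : ∀ l, l ∉ D → v l = 0) {V : ℝ} (hV0 : 0 ≤ V) (hV : ∀ l ∈ D, |v l| ≤ V)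
    {R : ℝ} (hR : ∀ i ∈ Z, ∀ l ∈ D, R ≤ d i l) :
    (S⁻¹ *ᵥ v) ⬝ᵥ (Q *ᵥ (S⁻¹ *ᵥ v)) ≤ q₀ * Z.card * (C * V * (D.card * Real.exp (-(μ * R)))) ^ 2 :=
  qf_le_card_mul_sq hQ Z hQZ hQq hq₀ _ fun i hi =>
    abs_inv_mulVec_le_buffer S d hdec D v hvD hV0 hV i hμ (hR i hi)

/-- **THE SAME, FED BY COMBES–THOMAS** (`C = 2∕σ` from §1): for a coercive banded `S` the induced-mean energy on a pinned
region `R` layers inside the near block is at most `q₀·#Z·((2∕σ)·V·#D·e^{−μR})²`. [folklore] -/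
theorem inducedMeanEnergy_le_of_banded (S Q : Matrix n n ℝ) (d : n → n → ℝ) (σ h z μ : ℝ) (hσ : 0 < σ) (hμ : 0 ≤ μ)
    (hd0 : ∀ i, d i i = 0) (hdsymm : ∀ i k, d i k = d k i) (hdtri : ∀ i j k, d i k ≤ d i j + d j k)
    (hband : ∀ i k, 1 < d i k → S i k = 0) (hh0 : 0 ≤ h) (hh : ∀ i k, i ≠ k → |S i k| ≤ h)
    (hz : ∀ i, ((univ.filter fun k => k ≠ i ∧ d i k ≤ 1).card : ℝ) ≤ z)
    (hpos : ∀ ω : n → ℝ, σ * (ω ⬝ᵥ ω) ≤ ω ⬝ᵥ S *ᵥ ω) (hsmall : h * z * (Real.exp μ - 1) ≤ σ / 2)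
    (hQ : Q.PosSemidef) (Z : Finset n) (hQZ : ∀ i j, j ∉ Z → Q i j = 0) {q₀ : ℝ} (hq₀ : 0 ≤ q₀)
    (hQq : (q₀ • (1 : Matrix n n ℝ) - Q).PosSemidef)
    (D : Finset n) (v : n → ℝ) (hvD : ∀ l, l ∉ D → v l = 0) {V : ℝ} (hV0 : 0 ≤ V) (hV : ∀ l ∈ D, |v l| ≤ V)
    {R : ℝ} (hR : ∀ i ∈ Z, ∀ l ∈ D, R ≤ d i l) :
    (S⁻¹ *ᵥ v) ⬝ᵥ (Q *ᵥ (S⁻¹ *ᵥ v)) ≤ q₀ * Z.card * (2 / σ * V * (D.card * Real.exp (-(μ * R)))) ^ 2 :=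
  inducedMeanEnergy_le_of_decay S Q d hμ
    (abs_inv_le_of_banded S d σ h z μ hσ hμ hd0 hdsymm hdtri hband hh0 hh hz hpos hsmall)
    hQ Z hQZ hq₀ hQq D v hvD hV0 hV hR

/-- **THE SHIFTED RESTRICTED MOMENT WITH THE BUFFER PRICE** = the OWNER's `…GaussianShiftedFibre.shiftedMoment_le_of_inducedMean_le`
with its displayed `hB` DISCHARGED by `inducedMeanEnergy_le_of_decay`: the exterior coupling costs
`exp((1+ε⁻¹)·q₀·#Z·(C·V·#D·e^{−μR})²)` — free of the far volume and of the far characteristic functions, and `O(q₀#Z)`-sized as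
soon as `e^{μR} ≥ C·V·#D`.  The translated mass `hmass` stays displayed (see §6). [folklore] -/
theorem shiftedMoment_le_of_decay {S Q : Matrix n n ℝ} {δ' ε η : ℝ} {r : ℕ} (hS : S.PosDef) (hQ : Q.PosSemidef)
    (hε : 0 < ε) (hdom : (δ' • S - (1 + ε) • Q).PosSemidef) (hδ0 : 0 ≤ δ') (hδ : δ' < 1) (hr : Q.rank ≤ r) (v : n → ℝ)
    {F : (n → ℝ) → ℝ} (hF0 : ∀ x, 0 ≤ F x) (hF1 : ∀ x, F x ≤ 1) (hFm : Measurable F) (hη : η < 1)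
    (hmass : ∫ u, (1 - F (u - S⁻¹ *ᵥ v)) * exp (-(u ⬝ᵥ (S *ᵥ u))) ≤ η * ∫ u, exp (-(u ⬝ᵥ (S *ᵥ u))))
    {C μ : ℝ} (d : n → n → ℝ) (hμ : 0 ≤ μ) (hdec : ∀ i k, |S⁻¹ i k| ≤ C * Real.exp (-(μ * d i k)))
    (Z : Finset n) (hQZ : ∀ i j, j ∉ Z → Q i j = 0) {q₀ : ℝ} (hq₀ : 0 ≤ q₀) (hQq : (q₀ • (1 : Matrix n n ℝ) - Q).PosSemidef)
    (D : Finset n) (hvD : ∀ l, l ∉ D → v l = 0) {V : ℝ} (hV0 : 0 ≤ V) (hV : ∀ l ∈ D, |v l| ≤ V)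
    {R : ℝ} (hR : ∀ i ∈ Z, ∀ l ∈ D, R ≤ d i l) :
    ∫ x, F x * (exp (x ⬝ᵥ (Q *ᵥ x)) * exp (-(x ⬝ᵥ (S *ᵥ x) + 2 * (x ⬝ᵥ v)))) ≤
      (exp ((1 + ε⁻¹) * (q₀ * Z.card * (C * V * (D.card * Real.exp (-(μ * R)))) ^ 2)) *
          ((√(1 - δ'))⁻¹ ^ r / (1 - η))) *
        ∫ x, F x * exp (-(x ⬝ᵥ (S *ᵥ x) + 2 * (x ⬝ᵥ v))) :=
  shiftedMoment_le_of_inducedMean_le hS hQ hε hdom hδ0 hδ hr v hF0 hF1 hFm hη hmass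
    (inducedMeanEnergy_le_of_decay S Q d hμ hdec hQ Z hQZ hq₀ hQq D v hvD hV0 hV hR)

/-! ## §6 Window nesting: the translated restriction's large-field mass (model lemma for (R1′c)) -/

omit [DecidableEq n] in
/-- **ONE WINDOW UNDER TRANSLATION.**  If the translated field violates the window, `θ ≤ (u − m)ᵀQ_b(u − m)`, and the induced
mean's energy in that window is `mᵀQ_bm ≤ μ_b`, then the UNTRANSLATED field violates the SHRUNKEN window:
`(θ − (1+ε⁻¹)μ_b)∕(1+ε) ≤ uᵀQ_bu` (`ε > 0`; Young). [folklore] -/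
theorem window_nesting {Qb : Matrix n n ℝ} (hQb : Qb.PosSemidef) (u w : n → ℝ) {θ μb ε : ℝ} (hε : 0 < ε)
    (hm : w ⬝ᵥ (Qb *ᵥ w) ≤ μb) (h : θ ≤ (u - w) ⬝ᵥ (Qb *ᵥ (u - w))) :
    (θ - (1 + ε⁻¹) * μb) / (1 + ε) ≤ u ⬝ᵥ (Qb *ᵥ u) := by
  have hy := qf_young hQb u w hε
  have h1 : (1 + ε⁻¹) * (w ⬝ᵥ (Qb *ᵥ w)) ≤ (1 + ε⁻¹) * μb := mul_le_mul_of_nonneg_left hm (by positivity)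
  rw [div_le_iff₀ (by linarith)]
  linarith

/-- **THE TRANSLATED LARGE-FIELD MASS AT NESTING LETTERS** — the OWNER's `…GaussianTranslatedMass.translatedLargeFieldMass_le`
(W-ne7bp1-g105-3: the translation lemma's locus; ALIASED here, not re-proved) read at letters `μ_b ≥ mᵀQ_bm` by monotonicity of the
bound: the translated restriction `F(· − m)` has large-field mass `≤ (Σ_b e^{−(θ_b − (1+ε⁻¹)μ_b)∕(1+ε)}·(√(1−δ))⁻¹ ^ {r_b}) · ∫ e^{−uᵀSu}`
— the shape of `shiftedMoment_le`'s `hmass`, small when the `μ_b` sit below the thresholds `θ_b` (whether print's letters do is (R1′c)'s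
maximum-principle clause, NOT decided here). [folklore] -/
theorem translatedMass_le {ι : Type*} (B : Finset ι) {S : Matrix n n ℝ} (Qb : ι → Matrix n n ℝ) (θ μb : ι → ℝ)
    (rb : ι → ℕ) {δ : ℝ} (hS : S.PosDef) (hQ : ∀ b ∈ B, (Qb b).PosSemidef)
    (hdom : ∀ b ∈ B, (δ • S - Qb b).PosSemidef) (hδ0 : 0 ≤ δ) (hδ : δ < 1) (hr : ∀ b ∈ B, (Qb b).rank ≤ rb b)
    {F : (n → ℝ) → ℝ} (hF1 : ∀ x, F x ≤ 1)
    (hcov : ∀ x, 1 - F x ≤ ∑ b ∈ B, Set.indicator {x | θ b ≤ x ⬝ᵥ (Qb b *ᵥ x)} (fun _ => (1 : ℝ)) x)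
    (w : n → ℝ) (hm : ∀ b ∈ B, w ⬝ᵥ (Qb b *ᵥ w) ≤ μb b) {ε : ℝ} (hε : 0 < ε) :
    ∫ u, (1 - F (u - w)) * exp (-(u ⬝ᵥ (S *ᵥ u))) ≤
      (∑ b ∈ B, exp (-((θ b - (1 + ε⁻¹) * μb b) / (1 + ε))) * (√(1 - δ))⁻¹ ^ rb b) *
        ∫ u, exp (-(u ⬝ᵥ (S *ᵥ u))) := by
  refine (translatedLargeFieldMass_le B Qb θ rb hS hQ hdom hδ0 hδ hr hε hF1 hcov w).trans
    (mul_le_mul_of_nonneg_right (Finset.sum_le_sum fun b hb => ?_) (integral_nonneg fun u => (exp_pos _).le))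
  refine mul_le_mul_of_nonneg_right (exp_le_exp.2 ?_) (pow_nonneg (inv_nonneg.2 (Real.sqrt_nonneg _)) _)
  have h1 : (1 + ε⁻¹) * (w ⬝ᵥ (Qb b *ᵥ w)) ≤ (1 + ε⁻¹) * μb b := mul_le_mul_of_nonneg_left (hm b hb) (by positivity)
  have h2 : 0 < 1 + ε := by linarith
  rw [neg_le_neg_iff, div_le_div_iff_of_pos_right h2]
  linarith

/-- **THE NESTING LETTERS FROM DECAY, WITHOUT A BUFFER** (windows may touch the interface): for a window form `Q_b` living on
`Z_b` with `Q_b ≤ q_b·1` and a non-negative pseudo-distance, `mᵀQ_bm ≤ q_b·#Z_b·(C·V·#D)²`. [folklore] -/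
theorem windowEnergy_le_of_decay (S Qb : Matrix n n ℝ) {C μ : ℝ} (d : n → n → ℝ) (hμ : 0 ≤ μ)
    (hdnn : ∀ i l, 0 ≤ d i l) (hdec : ∀ i k, |S⁻¹ i k| ≤ C * Real.exp (-(μ * d i k)))
    (hQb : Qb.PosSemidef) (Zb : Finset n) (hQZ : ∀ i j, j ∉ Zb → Qb i j = 0) {qb : ℝ} (hqb : 0 ≤ qb)
    (hQq : (qb • (1 : Matrix n n ℝ) - Qb).PosSemidef)
    (D : Finset n) (v : n → ℝ) (hvD : ∀ l, l ∉ D → v l = 0) {V : ℝ} (hV0 : 0 ≤ V) (hV : ∀ l ∈ D, |v l| ≤ V) :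
    (S⁻¹ *ᵥ v) ⬝ᵥ (Qb *ᵥ (S⁻¹ *ᵥ v)) ≤ qb * Zb.card * (C * V * D.card) ^ 2 := by
  have h := inducedMeanEnergy_le_of_decay S Qb d hμ hdec hQb Zb hQZ hqb hQq D v hvD hV0 hV
    (R := 0) (fun i _ l _ => hdnn i l)
  simpa only [mul_zero, neg_zero, Real.exp_zero, mul_one] using h

/-! ## §7 A decided toy: the §1 hypotheses are jointly inhabited -/

/-- TOY: on two sites with `S = 1`, the discrete distance, `σ = 1`, `h = 0`, `z = 2`, `μ = 1`, every hypothesis of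
`abs_inv_le_of_banded` holds, and the conclusion reads `|S⁻¹ i k| ≤ 2·e^{−d(i,k)}`. [folklore] -/
example (i k : Fin 2) :
    |(1 : Matrix (Fin 2) (Fin 2) ℝ)⁻¹ i k| ≤ 2 / 1 * Real.exp (-(1 * (if i = k then (0 : ℝ) else 1))) := by
  refine abs_inv_le_of_banded (1 : Matrix (Fin 2) (Fin 2) ℝ) (fun i k => if i = k then (0 : ℝ) else 1) 1 0 2 1
    one_pos zero_le_one (fun i => by simp) (fun i k => by by_cases h : i = k <;> simp [h, eq_comm])
    (fun i j k => by by_cases h1 : i = k <;> by_cases h2 : i = j <;> by_cases h3 : j = k <;> simp_all)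
    (fun i k hik => by
      by_cases h : i = k
      · norm_num [h] at hik
      · simp [h])
    le_rfl (fun i k hik => by simp [hik])
    (fun i => by
      have h1 : (univ.filter fun k : Fin 2 => k ≠ i ∧ (if i = k then (0 : ℝ) else 1) ≤ 1).card ≤ 2 :=
        (Finset.card_filter_le _ _).trans (by simp)
      exact_mod_cast h1)
    (fun ω => by rw [Matrix.one_mulVec, one_mul]) (by norm_num) i k

end Summit.QuantumFields.BalabanUV.T4Continuum.NE7b.GaussianInducedMeanDecay
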